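import Summits.ABC.ABC.Theorems.TowerFourSubLiouville.Negative.CriticalLineTwoSevenths
import Summits.ABC.ABC.Theorems.TowerFourSubLiouville.Negative.DirichletEdgeTwist

/-!
# `TowerFourSubLiouville` (stmt-ABC-1649): the lobe `{θ ≥ 2/13, φ > 24/13}` at the line point `(2/13, 24/13)`, the edge point
`(2/13, 2)`, and the FALSE region after cycle 16

Part 3 of the cycle-16 module of the standing disprover (see `Negative.CriticalLineStep`, `Negative.CriticalLineTwoSevenths`).
The `z = 2` Padé step `(N+1)(64N²+56N+7)⁴ − N(64N²+72N+15)⁴ = 86016N⁴ + 172032N³ + 114624N² + 28608N + 2401` fed with the value-`1`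
Pell–Bezout family of `Negative.AxisBoundary` on the Pell indices `n ≡ 1 (mod 24)` (`s ≡ 1 (mod 105)`; the obstruction prime of the
`z = 2` step is `7`) is the coprime family

  `(v, w, Y, Z) = (6s² − 1, (2s² + 1)/3, u·(64N² + 72N + 15), 3s·(64N² + 56N + 7))`,  `N = v·u⁴`

(`exists_lineFamily₂`; no twist: `3 ∥ 64N² + 56N + 7` sits on the `Z`-side), with the exact height certificate `v¹³ ≤ Z²`
(`θ = 2/13`), the exact edge certificate `a ≤ Z²` (`s ≥ 4`), and the near-line certificate `192²⁴·a¹³ ≤ 403681¹³·96⁴·Z²⁴`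
(exponent `24/13`, constant `≈ 18^{13}` — the exact corner `(2/13, 24/13)` would need a `q`-adic twist with `q ≥ 5`, i.e. `11⁴ ∣ w₀`,
first met at Pell index `3328`).  Consequences:
* `not_ubq₂_of_twoThirteenths_le`: **`UBQ₂(θ, φ)` is FALSE for every `θ ≥ 2/13`, `φ > 24/13`** (false points converging to the
  line point `(2/13, 24/13)`); `not_ubq₂_of_twoThirteenths_le_of_two_le`, `not_ubq₂_twoThirteenths_two`: the Dirichlet-edge point
  `(2/13, 2)` and its closed lobe;
* `ubq₂_false_of_corner₁₁`: **FALSE region `{θ≥2, φ≥0} ∪ {θ≥1, φ≥3/2} ∪ {θ≥2/7, φ≥12/7} ∪ {θ≥2/13, φ>24/13} ∪ {θ>0, φ>2}`**;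
  the open boundary segment of the Dirichlet edge is now `{0 < θ < 2/13, φ = 2}`; the general `[z/z]` step would give the line points
  `(2/(6z+1), 12z/(6z+1))` for every `z`, accumulating at the TRUE point `(0, 2)` (p137751).
Calibration, not a kill.
-/


-- `Summit.ABC.ABC` is the mandated summit-side namespace (CONVENTIONS §2); the duplicate is deliberate.
set_option linter.dupNamespace false

namespace Summit.ABC.ABC.Theorems.TowerFourSubLiouville.Negative

/-! ## The `z = 2` line family (untwisted): `(v, w, Y, Z) = (6s² − 1, (2s²+1)/3, u(64N²+72N+15), 3s(64N²+56N+7))` -/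

/-- Base relation (the value-`1` identity of p152685, reshaped): `81·w·s⁴ = v·u⁴ + 1`. -/
theorem lineFamily₂_base {u s v w : ℕ} (hu : u ^ 2 = 3 * s ^ 2 + 1) (hv : v + 1 = 6 * s ^ 2)
    (hw : 3 * w = 2 * s ^ 2 + 1) : 81 * (w * s ^ 4) = v * u ^ 4 + 1 := by
  have hu' : ((u : ℤ)) ^ 2 = 3 * (s : ℤ) ^ 2 + 1 := by exact_mod_cast hu
  have hv' : (v : ℤ) + 1 = 6 * (s : ℤ) ^ 2 := by exact_mod_cast hv
  have hw' : 3 * (w : ℤ) = 2 * (s : ℤ) ^ 2 + 1 := by exact_mod_cast hw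
  have : (81 : ℤ) * ((w : ℤ) * (s : ℤ) ^ 4) = (v : ℤ) * (u : ℤ) ^ 4 + 1 := by
    linear_combination (27 * (s : ℤ) ^ 4) * hw' - ((u : ℤ) ^ 4) * hv'
      - ((6 * (s : ℤ) ^ 2 - 1) * ((u : ℤ) ^ 2 + 3 * (s : ℤ) ^ 2 + 1)) * hu'
  exact_mod_cast this

/-- **The identity of the `z = 2` line family** (`N = vu⁴`):
`w·(3s(64N²+56N+7))⁴ = v·(u(64N²+72N+15))⁴ + (86016N⁴ + 172032N³ + 114624N² + 28608N + 2401)`. -/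
theorem lineFamily₂_identity {u s v w : ℕ} (hu : u ^ 2 = 3 * s ^ 2 + 1) (hv : v + 1 = 6 * s ^ 2)
    (hw : 3 * w = 2 * s ^ 2 + 1) :
    w * (3 * s * (64 * (v * u ^ 4) ^ 2 + 56 * (v * u ^ 4) + 7)) ^ 4
      = v * (u * (64 * (v * u ^ 4) ^ 2 + 72 * (v * u ^ 4) + 15)) ^ 4
        + (86016 * (v * u ^ 4) ^ 4 + 172032 * (v * u ^ 4) ^ 3 + 114624 * (v * u ^ 4) ^ 2 + 28608 * (v * u ^ 4) + 2401) := by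
  have hB := lineFamily₂_base hu hv hw
  have hBz : (81 : ℤ) * ((w : ℤ) * (s : ℤ) ^ 4) = (v : ℤ) * (u : ℤ) ^ 4 + 1 := by exact_mod_cast hB
  have key : (w : ℤ) * (3 * s * (64 * ((v : ℤ) * (u : ℤ) ^ 4) ^ 2 + 56 * ((v : ℤ) * (u : ℤ) ^ 4) + 7)) ^ 4
      = v * ((u : ℤ) * (64 * ((v : ℤ) * (u : ℤ) ^ 4) ^ 2 + 72 * ((v : ℤ) * (u : ℤ) ^ 4) + 15)) ^ 4
        + (86016 * ((v : ℤ) * (u : ℤ) ^ 4) ^ 4 + 172032 * ((v : ℤ) * (u : ℤ) ^ 4) ^ 3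
            + 114624 * ((v : ℤ) * (u : ℤ) ^ 4) ^ 2 + 28608 * ((v : ℤ) * (u : ℤ) ^ 4) + 2401) := by
    linear_combination (64 * ((v : ℤ) * (u : ℤ) ^ 4) ^ 2 + 56 * ((v : ℤ) * (u : ℤ) ^ 4) + 7) ^ 4 * hBz
  exact_mod_cast key

/-- **Coprimality of the `z = 2` line family** on the good classes (`3 ∤ s` via `3w = 2s²+1`, `s ≡ 1 (mod 5)`, `s ≡ ±1 (mod 7)`;
the obstruction prime of the `z = 2` step is `7`: `S² ± S − 5 ≡ 7` at `N ≡ 0, −1`). -/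
theorem lineFamily₂_coprime {u s v w : ℕ} (hu : u ^ 2 = 3 * s ^ 2 + 1) (hv : v + 1 = 6 * s ^ 2)
    (hw : 3 * w = 2 * s ^ 2 + 1) (h5 : s % 5 = 1) (h7 : s % 7 = 1 ∨ s % 7 = 6) :
    Nat.Coprime (v * (u * (64 * (v * u ^ 4) ^ 2 + 72 * (v * u ^ 4) + 15)))
      (w * (3 * s * (64 * (v * u ^ 4) ^ 2 + 56 * (v * u ^ 4) + 7))) := by
  have hB := lineFamily₂_base hu hv hw
  have hBz : (81 : ℤ) * ((w : ℤ) * (s : ℤ) ^ 4) = (v : ℤ) * (u : ℤ) ^ 4 + 1 := by exact_mod_cast hB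
  have hs7 : s ^ 2 % 7 = 1 := by
    rcases h7 with h | h <;> simp [Nat.pow_mod, h]
  have hs5 : s ^ 2 % 5 = 1 := by simp [Nat.pow_mod, h5]
  have p7 : Nat.Prime 7 := by norm_num
  -- (a) `gcd(vu, 3ws) = 1` from the value-`1` base relation
  have ha : Nat.Coprime (v * u) (w * (3 * s)) :=
    coprime_of_int_combination (a := -((u : ℤ) ^ 3)) (b := 27 * (s : ℤ) ^ 3) (r := 1)
      (by push_cast; linear_combination hBz) (Nat.coprime_one_left _)
  -- (b) `gcd(vu, 64N²+56N+7) ∣ 7`, `7 ∤ vu`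
  have h7v : ¬ 7 ∣ v := by omega
  have h7u : ¬ 7 ∣ u := by
    intro hd
    have : 7 ∣ u ^ 2 := dvd_pow hd two_ne_zero
    omega
  have h7vu : Nat.Coprime 7 (v * u) :=
    Nat.Coprime.mul_right ((Nat.Prime.coprime_iff_not_dvd p7).mpr h7v) ((Nat.Prime.coprime_iff_not_dvd p7).mpr h7u)
  have hb : Nat.Coprime (v * u) (64 * (v * u ^ 4) ^ 2 + 56 * (v * u ^ 4) + 7) :=
    coprime_of_int_combination (a := -(64 * ((v : ℤ) * (u : ℤ) ^ 4) * (u : ℤ) ^ 3 + 56 * (u : ℤ) ^ 3)) (b := 1) (r := 7)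
      (by push_cast; ring) h7vu
  -- (c) `gcd(3ws, 64N²+72N+15) ∣ 7`, `7 ∤ 3ws`
  have h7w : ¬ 7 ∣ w := by omega
  have h7s : ¬ 7 ∣ s := by omega
  have h7ws : Nat.Coprime 7 (w * (3 * s)) :=
    Nat.Coprime.mul_right ((Nat.Prime.coprime_iff_not_dvd p7).mpr h7w)
      (Nat.Coprime.mul_right (by norm_num) ((Nat.Prime.coprime_iff_not_dvd p7).mpr h7s))
  have hc : Nat.Coprime (w * (3 * s)) (64 * (v * u ^ 4) ^ 2 + 72 * (v * u ^ 4) + 15) :=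
    coprime_of_int_combination
      (a := -(64 * (81 * ((w : ℤ) * (s : ℤ) ^ 4)) - 56) * (27 * (s : ℤ) ^ 3)) (b := 1) (r := 7)
      (by
        push_cast
        linear_combination (-(64 * (81 * ((w : ℤ) * (s : ℤ) ^ 4)) + 64 * ((v : ℤ) * (u : ℤ) ^ 4) + 8)) * hBz)
      h7ws
  -- (d) `gcd(64N²+56N+7, 64N²+72N+15) ∣ 20`, and `64N²+56N+7` is odd and `≡ 2 (mod 5)` (`5 ∣ v ∣ N`)
  have h5v : 5 ∣ v := by omega
  have h5N2 : 5 ∣ (v * u ^ 4) ^ 2 := dvd_pow (dvd_mul_of_dvd_left h5v _) two_ne_zero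
  have h5N : 5 ∣ v * u ^ 4 := dvd_mul_of_dvd_left h5v _
  have h2P : Nat.Coprime 2 (64 * (v * u ^ 4) ^ 2 + 56 * (v * u ^ 4) + 7) :=
    (Nat.Prime.coprime_iff_not_dvd Nat.prime_two).mpr (by omega)
  have h5P : Nat.Coprime 5 (64 * (v * u ^ 4) ^ 2 + 56 * (v * u ^ 4) + 7) :=
    (Nat.Prime.coprime_iff_not_dvd Nat.prime_five).mpr (by omega)
  have h20P : Nat.Coprime 20 (64 * (v * u ^ 4) ^ 2 + 56 * (v * u ^ 4) + 7) := by
    have := Nat.Coprime.mul_left (Nat.Coprime.pow_left 2 h2P) h5P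
    simpa using this
  have hd : Nat.Coprime (64 * (v * u ^ 4) ^ 2 + 56 * (v * u ^ 4) + 7) (64 * (v * u ^ 4) ^ 2 + 72 * (v * u ^ 4) + 15) :=
    coprime_of_int_combination
      (a := (64 * ((v : ℤ) * (u : ℤ) ^ 4) ^ 2 + 56 * ((v : ℤ) * (u : ℤ) ^ 4) + 7) - 2)
      (b := (64 * ((v : ℤ) * (u : ℤ) ^ 4) ^ 2 + 72 * ((v : ℤ) * (u : ℤ) ^ 4) + 15)
        - 2 * (64 * ((v : ℤ) * (u : ℤ) ^ 4) ^ 2 + 56 * ((v : ℤ) * (u : ℤ) ^ 4) + 7) - 2)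
      (r := 20) (by push_cast; ring) h20P
  have h1 : Nat.Coprime (v * u) (w * (3 * s) * (64 * (v * u ^ 4) ^ 2 + 56 * (v * u ^ 4) + 7)) :=
    Nat.Coprime.mul_right ha hb
  have h2 : Nat.Coprime (64 * (v * u ^ 4) ^ 2 + 72 * (v * u ^ 4) + 15)
      (w * (3 * s) * (64 * (v * u ^ 4) ^ 2 + 56 * (v * u ^ 4) + 7)) :=
    Nat.Coprime.mul_right hc.symm hd.symm
  have h12 := Nat.Coprime.mul_left h1 h2
  have e1 : v * (u * (64 * (v * u ^ 4) ^ 2 + 72 * (v * u ^ 4) + 15))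
      = v * u * (64 * (v * u ^ 4) ^ 2 + 72 * (v * u ^ 4) + 15) := by ring
  have e2 : w * (3 * s * (64 * (v * u ^ 4) ^ 2 + 56 * (v * u ^ 4) + 7))
      = w * (3 * s) * (64 * (v * u ^ 4) ^ 2 + 56 * (v * u ^ 4) + 7) := by ring
  rw [e1, e2]
  exact h12

/-- **Height certificate of the `z = 2` line family**: `v¹³ ≤ Z²` (exact: `θ = 2/13`). -/
theorem lineFamily₂_height {u s v : ℕ} (hu : u ^ 2 = 3 * s ^ 2 + 1) (hv : v + 1 = 6 * s ^ 2) :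
    v ^ 13 ≤ (3 * s * (64 * (v * u ^ 4) ^ 2 + 56 * (v * u ^ 4) + 7)) ^ 2 := by
  have hu4 := pell3_nine_mul_pow_four_le hu
  have hv6 : v ≤ 6 * s ^ 2 := by omega
  rcases Nat.eq_zero_or_pos s with h0 | hs1
  · subst h0; simp at hv
  have hs2 : 1 ≤ s ^ 2 := Nat.one_le_pow _ _ hs1
  have hv5 : 5 * s ^ 2 ≤ v := by omega
  have hN45 : 45 * s ^ 6 ≤ v * u ^ 4 := by
    calc 45 * s ^ 6 = (5 * s ^ 2) * (9 * s ^ 4) := by ring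
      _ ≤ v * u ^ 4 := Nat.mul_le_mul hv5 hu4
  have hZ : 388800 * s ^ 13 ≤ 3 * s * (64 * (v * u ^ 4) ^ 2 + 56 * (v * u ^ 4) + 7) := by
    have e : 3 * s * (64 * (v * u ^ 4) ^ 2 + 56 * (v * u ^ 4) + 7)
        = 192 * (s * (v * u ^ 4) ^ 2) + (168 * (s * (v * u ^ 4)) + 21 * s) := by ring
    calc 388800 * s ^ 13 = 192 * (s * (45 * s ^ 6) ^ 2) := by ring
      _ ≤ 192 * (s * (v * u ^ 4) ^ 2) := by gcongr
      _ ≤ 192 * (s * (v * u ^ 4) ^ 2) + (168 * (s * (v * u ^ 4)) + 21 * s) := Nat.le_add_right _ _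
      _ = 3 * s * (64 * (v * u ^ 4) ^ 2 + 56 * (v * u ^ 4) + 7) := e.symm
  calc v ^ 13 ≤ (6 * s ^ 2) ^ 13 := Nat.pow_le_pow_left hv6 13
    _ = 13060694016 * s ^ 26 := by ring
    _ ≤ 151165440000 * s ^ 26 := Nat.mul_le_mul_right _ (by norm_num)
    _ = (388800 * s ^ 13) ^ 2 := by ring
    _ ≤ (3 * s * (64 * (v * u ^ 4) ^ 2 + 56 * (v * u ^ 4) + 7)) ^ 2 := Nat.pow_le_pow_left hZ 2

/-- Crude value bound of the `z = 2` line family: `a ≤ 403681·N⁴`. -/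
theorem lineFamily₂_value_le {N : ℕ} (hN : 1 ≤ N) :
    86016 * N ^ 4 + 172032 * N ^ 3 + 114624 * N ^ 2 + 28608 * N + 2401 ≤ 403681 * N ^ 4 := by
  have h2 : N ^ 2 ≤ N ^ 4 := Nat.pow_le_pow_right hN (by norm_num)
  have h3 : N ^ 3 ≤ N ^ 4 := Nat.pow_le_pow_right hN (by norm_num)
  have h1 : N ≤ N ^ 4 := by
    calc N = N ^ 1 := (pow_one N).symm
      _ ≤ N ^ 4 := Nat.pow_le_pow_right hN (by norm_num)
  have h0 : 1 ≤ N ^ 4 := Nat.one_le_pow _ _ hN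
  omega

/-- **Value certificate of the `z = 2` line family at the edge**: `a ≤ Z²` as soon as `s ≥ 4` (exact point `(2/13, 2)`). -/
theorem lineFamily₂_value_edge {u s v : ℕ} (hu : u ^ 2 = 3 * s ^ 2 + 1) (hv : v + 1 = 6 * s ^ 2) (hs : 4 ≤ s) :
    86016 * (v * u ^ 4) ^ 4 + 172032 * (v * u ^ 4) ^ 3 + 114624 * (v * u ^ 4) ^ 2 + 28608 * (v * u ^ 4) + 2401
      ≤ (3 * s * (64 * (v * u ^ 4) ^ 2 + 56 * (v * u ^ 4) + 7)) ^ 2 := by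
  have hu0 : 0 < u := by
    rcases Nat.eq_zero_or_pos u with h0 | h0
    · subst h0; simp at hu
    · exact h0
  have hv0 : 0 < v := by nlinarith
  have hN : 1 ≤ v * u ^ 4 := Nat.mul_pos hv0 (by positivity)
  have hZ : 192 * (s * (v * u ^ 4) ^ 2) ≤ 3 * s * (64 * (v * u ^ 4) ^ 2 + 56 * (v * u ^ 4) + 7) := by
    have e : 3 * s * (64 * (v * u ^ 4) ^ 2 + 56 * (v * u ^ 4) + 7)
        = 192 * (s * (v * u ^ 4) ^ 2) + (168 * (s * (v * u ^ 4)) + 21 * s) := by ring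
    rw [e]; exact Nat.le_add_right _ _
  have hs2 : 16 ≤ s ^ 2 := by nlinarith
  calc 86016 * (v * u ^ 4) ^ 4 + 172032 * (v * u ^ 4) ^ 3 + 114624 * (v * u ^ 4) ^ 2 + 28608 * (v * u ^ 4) + 2401
      ≤ 403681 * (v * u ^ 4) ^ 4 := lineFamily₂_value_le hN
    _ ≤ (36864 * 16) * (v * u ^ 4) ^ 4 := Nat.mul_le_mul_right _ (by norm_num)
    _ ≤ (36864 * s ^ 2) * (v * u ^ 4) ^ 4 := by gcongr
    _ = (192 * (s * (v * u ^ 4) ^ 2)) ^ 2 := by ring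
    _ ≤ (3 * s * (64 * (v * u ^ 4) ^ 2 + 56 * (v * u ^ 4) + 7)) ^ 2 := Nat.pow_le_pow_left hZ 2

/-- **Value certificate of the `z = 2` line family near the line**: `192²⁴·a¹³ ≤ (403681¹³·96⁴)·Z²⁴`
(the exponent `24/13` exactly, the constant not `1`). -/
theorem lineFamily₂_value_cert {u s v : ℕ} (hu : u ^ 2 = 3 * s ^ 2 + 1) (hv : v + 1 = 6 * s ^ 2) (hs : 1 ≤ s) :
    192 ^ 24 * (86016 * (v * u ^ 4) ^ 4 + 172032 * (v * u ^ 4) ^ 3 + 114624 * (v * u ^ 4) ^ 2 + 28608 * (v * u ^ 4) + 2401) ^ 13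
      ≤ (403681 ^ 13 * 96 ^ 4) * (3 * s * (64 * (v * u ^ 4) ^ 2 + 56 * (v * u ^ 4) + 7)) ^ 24 := by
  have hu0 : 0 < u := by
    rcases Nat.eq_zero_or_pos u with h0 | h0
    · subst h0; simp at hu
    · exact h0
  have hv0 : 0 < v := by nlinarith
  have hN : 1 ≤ v * u ^ 4 := Nat.mul_pos hv0 (by positivity)
  have hv6 : v ≤ 6 * s ^ 2 := by omega
  have hs2 : 1 ≤ s ^ 2 := Nat.one_le_pow _ _ hs
  have hu2 : u ^ 2 ≤ 4 * s ^ 2 := by omega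
  have hu4 : u ^ 4 ≤ 16 * s ^ 4 := by
    calc u ^ 4 = (u ^ 2) ^ 2 := by ring
      _ ≤ (4 * s ^ 2) ^ 2 := Nat.pow_le_pow_left hu2 2
      _ = 16 * s ^ 4 := by ring
  have hN96 : v * u ^ 4 ≤ 96 * s ^ 6 := by
    calc v * u ^ 4 ≤ (6 * s ^ 2) * (16 * s ^ 4) := Nat.mul_le_mul hv6 hu4
      _ = 96 * s ^ 6 := by ring
  have hZ : 192 * (s * (v * u ^ 4) ^ 2) ≤ 3 * s * (64 * (v * u ^ 4) ^ 2 + 56 * (v * u ^ 4) + 7) := by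
    have e : 3 * s * (64 * (v * u ^ 4) ^ 2 + 56 * (v * u ^ 4) + 7)
        = 192 * (s * (v * u ^ 4) ^ 2) + (168 * (s * (v * u ^ 4)) + 21 * s) := by ring
    rw [e]; exact Nat.le_add_right _ _
  have ha := lineFamily₂_value_le hN
  calc 192 ^ 24 * (86016 * (v * u ^ 4) ^ 4 + 172032 * (v * u ^ 4) ^ 3 + 114624 * (v * u ^ 4) ^ 2
          + 28608 * (v * u ^ 4) + 2401) ^ 13
      ≤ 192 ^ 24 * (403681 * (v * u ^ 4) ^ 4) ^ 13 := by gcongr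
    _ = 403681 ^ 13 * (192 ^ 24 * (v * u ^ 4) ^ 48) * (v * u ^ 4) ^ 4 := by ring
    _ ≤ 403681 ^ 13 * (192 ^ 24 * (v * u ^ 4) ^ 48) * (96 * s ^ 6) ^ 4 := by gcongr
    _ = (403681 ^ 13 * 96 ^ 4) * (192 * (s * (v * u ^ 4) ^ 2)) ^ 24 := by ring
    _ ≤ (403681 ^ 13 * 96 ^ 4) * (3 * s * (64 * (v * u ^ 4) ^ 2 + 56 * (v * u ^ 4) + 7)) ^ 24 := by gcongr

/-- **The `z = 2` line family packaged**: beyond every bound a coprime quadruple with `wZ⁴ = vY⁴ + a`, `0 < a`, `max(v, w) = v`,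
`v¹³ ≤ Z²`, `a ≤ Z²` and `192²⁴a¹³ ≤ 403681¹³96⁴·Z²⁴`. -/
theorem exists_lineFamily₂ (B : ℕ) : ∃ v w Y Z a : ℕ, B ≤ Z ∧ 1 ≤ Z ∧ 0 < v ∧ 0 < w ∧ 0 < Y ∧ 0 < a ∧
    Nat.Coprime (v * Y) (w * Z) ∧ w * Z ^ 4 = v * Y ^ 4 + a ∧ w ≤ v ∧ v ^ 13 ≤ Z ^ 2 ∧ a ≤ Z ^ 2 ∧
    192 ^ 24 * a ^ 13 ≤ (403681 ^ 13 * 96 ^ 4) * Z ^ 24 := by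
  obtain ⟨u, s, hu, hBs, h105⟩ := pell3_good105_exists_ge (max B 4)
  have hB' : B ≤ s := le_trans (le_max_left _ _) hBs
  have hs4 : 4 ≤ s := le_trans (le_max_right _ _) hBs
  have h3 : s % 3 = 1 := by omega
  have h5 : s % 5 = 1 := by omega
  have h7 : s % 7 = 1 ∨ s % 7 = 6 := Or.inl (by omega)
  obtain ⟨w, hw⟩ : 3 ∣ 2 * s ^ 2 + 1 := by
    have : s ^ 2 % 3 = 1 := by simp [Nat.pow_mod, h3]
    omega
  have hw' : 3 * w = 2 * s ^ 2 + 1 := hw.symm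
  have hs2 : 16 ≤ s ^ 2 := by nlinarith
  obtain ⟨v, hv⟩ : ∃ v : ℕ, v + 1 = 6 * s ^ 2 := ⟨6 * s ^ 2 - 1, by omega⟩
  have hu0 : 0 < u := by
    rcases Nat.eq_zero_or_pos u with h0 | h0
    · subst h0; simp at hu
    · exact h0
  have hv0 : 0 < v := by omega
  have e : 3 * s * (64 * (v * u ^ 4) ^ 2 + 56 * (v * u ^ 4) + 7)
      = 192 * (s * (v * u ^ 4) ^ 2) + (168 * (s * (v * u ^ 4)) + 21 * s) := by ring
  refine ⟨v, w, u * (64 * (v * u ^ 4) ^ 2 + 72 * (v * u ^ 4) + 15), 3 * s * (64 * (v * u ^ 4) ^ 2 + 56 * (v * u ^ 4) + 7),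
    86016 * (v * u ^ 4) ^ 4 + 172032 * (v * u ^ 4) ^ 3 + 114624 * (v * u ^ 4) ^ 2 + 28608 * (v * u ^ 4) + 2401,
    by omega, by omega, hv0, by omega, by positivity, by positivity, lineFamily₂_coprime hu hv hw' h5 h7,
    lineFamily₂_identity hu hv hw', by omega, lineFamily₂_height hu hv, lineFamily₂_value_edge hu hv hs4,
    lineFamily₂_value_cert hu hv (by omega)⟩

/-! ## The lobe `{θ ≥ 2/13, φ > 24/13}` and the edge point `(2/13, 2)` -/

/-- **`UBQ₂(θ, φ)` fails for every `θ ≥ 2/13` and every `φ > 24/13`** — false points converging to the line point `(2/13, 24/13)`. -/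
theorem not_ubq₂_of_twoThirteenths_le (θ φ : ℝ) (hθ : 2 / 13 ≤ θ) (hφ : 24 / 13 < φ) :
    ¬ ∃ Z₀ : ℕ, ∀ v w Y Z : ℕ, Z₀ ≤ Z → 0 < v → 0 < w → 0 < Y → Nat.Coprime (v * Y) (w * Z) →
      ((max v w : ℕ) : ℝ) ≤ (Z : ℝ) ^ θ → w * Z ^ 4 ≠ v * Y ^ 4 →
      (Z : ℝ) ^ φ < |((w * Z ^ 4 : ℕ) : ℝ) - ((v * Y ^ 4 : ℕ) : ℝ)| := by
  rintro ⟨Z₀, h⟩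
  set C : ℝ := (((403681 ^ 13 * 96 ^ 4 : ℕ) : ℝ) / ((192 ^ 24 : ℕ) : ℝ)) ^ ((1 : ℝ) / ((13 : ℕ) : ℝ)) with hC
  obtain ⟨N₁, hN₁⟩ := eventually_const_mul_rpow_le C (((24 : ℕ) : ℝ) / ((13 : ℕ) : ℝ)) φ (by norm_num; exact hφ)
  obtain ⟨v, w, Y, Z, a, hNZ, hZ1, hv, hw, hY, ha, hcop, hid, hwv, hv13, -, hcert⟩ := exists_lineFamily₂ (max Z₀ N₁)
  have hZ₀ : Z₀ ≤ Z := le_trans (le_max_left _ _) hNZ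
  have hN₁Z : N₁ ≤ Z := le_trans (le_max_right _ _) hNZ
  have hZR : (1 : ℝ) ≤ Z := by exact_mod_cast hZ1
  have hmax : ((max v w : ℕ) : ℝ) ≤ (Z : ℝ) ^ θ := by
    rw [max_eq_left hwv]
    have h1 : (v : ℝ) ≤ (Z : ℝ) ^ ((2 : ℝ) / 13) := by
      have := natCast_le_rpow_div_of_pow_le (p := 2) (q := 13) (by norm_num) hv13
      norm_num at this
      exact this
    exact h1.trans (Real.rpow_le_rpow_of_exponent_le hZR hθ)
  have hne : w * Z ^ 4 ≠ v * Y ^ 4 := by rw [hid]; omega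
  have key := h v w Y Z hZ₀ hv hw hY hcop hmax hne
  have habs : |((w * Z ^ 4 : ℕ) : ℝ) - ((v * Y ^ 4 : ℕ) : ℝ)| = (a : ℝ) := by
    rw [hid]; push_cast
    rw [show (((v : ℝ) * (Y : ℝ) ^ 4 + (a : ℝ)) - (v : ℝ) * (Y : ℝ) ^ 4) = (a : ℝ) by ring]
    exact abs_of_nonneg (by positivity)
  rw [habs] at key
  have haR : (a : ℝ) ≤ C * (Z : ℝ) ^ (((24 : ℕ) : ℝ) / ((13 : ℕ) : ℝ)) :=
    natCast_le_mul_rpow_of_mul_pow_le (x := a) (Z := Z) (p := 24) (q := 13) (c₁ := 192 ^ 24)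
      (c₂ := 403681 ^ 13 * 96 ^ 4) (by norm_num) (by norm_num) hcert
  have h2 := hN₁ Z hN₁Z
  linarith

/-- **The Dirichlet-edge point `(2/13, 2)` is false** (and the whole lobe `{θ ≥ 2/13, φ ≥ 2}`, via `a ≤ Z²` from `s ≥ 4` on). -/
theorem not_ubq₂_of_twoThirteenths_le_of_two_le (θ φ : ℝ) (hθ : 2 / 13 ≤ θ) (hφ : 2 ≤ φ) :
    ¬ ∃ Z₀ : ℕ, ∀ v w Y Z : ℕ, Z₀ ≤ Z → 0 < v → 0 < w → 0 < Y → Nat.Coprime (v * Y) (w * Z) →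
      ((max v w : ℕ) : ℝ) ≤ (Z : ℝ) ^ θ → w * Z ^ 4 ≠ v * Y ^ 4 →
      (Z : ℝ) ^ φ < |((w * Z ^ 4 : ℕ) : ℝ) - ((v * Y ^ 4 : ℕ) : ℝ)| := by
  rintro ⟨Z₀, h⟩
  obtain ⟨v, w, Y, Z, a, hNZ, hZ1, hv, hw, hY, ha, hcop, hid, hwv, hv13, haZ, -⟩ := exists_lineFamily₂ Z₀
  have hZR : (1 : ℝ) ≤ Z := by exact_mod_cast hZ1
  have hmax : ((max v w : ℕ) : ℝ) ≤ (Z : ℝ) ^ θ := by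
    rw [max_eq_left hwv]
    have h1 : (v : ℝ) ≤ (Z : ℝ) ^ ((2 : ℝ) / 13) := by
      have := natCast_le_rpow_div_of_pow_le (p := 2) (q := 13) (by norm_num) hv13
      norm_num at this
      exact this
    exact h1.trans (Real.rpow_le_rpow_of_exponent_le hZR hθ)
  have hne : w * Z ^ 4 ≠ v * Y ^ 4 := by rw [hid]; omega
  have key := h v w Y Z hNZ hv hw hY hcop hmax hne
  have habs : |((w * Z ^ 4 : ℕ) : ℝ) - ((v * Y ^ 4 : ℕ) : ℝ)| = (a : ℝ) := by
    rw [hid]; push_cast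
    rw [show (((v : ℝ) * (Y : ℝ) ^ 4 + (a : ℝ)) - (v : ℝ) * (Y : ℝ) ^ 4) = (a : ℝ) by ring]
    exact abs_of_nonneg (by positivity)
  rw [habs] at key
  have haR : (a : ℝ) ≤ (Z : ℝ) ^ (2 : ℕ) := by
    have : ((a : ℕ) : ℝ) ≤ ((Z ^ 2 : ℕ) : ℝ) := by exact_mod_cast haZ
    push_cast at this; exact this
  have h2 : (Z : ℝ) ^ (2 : ℕ) ≤ (Z : ℝ) ^ φ := by
    rw [← Real.rpow_natCast]
    exact Real.rpow_le_rpow_of_exponent_le hZR (by exact_mod_cast hφ)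
  linarith

/-- **The Dirichlet-edge point `(2/13, 2)` itself.** -/
theorem not_ubq₂_twoThirteenths_two :
    ¬ ∃ Z₀ : ℕ, ∀ v w Y Z : ℕ, Z₀ ≤ Z → 0 < v → 0 < w → 0 < Y → Nat.Coprime (v * Y) (w * Z) →
      ((max v w : ℕ) : ℝ) ≤ (Z : ℝ) ^ (2 / 13 : ℝ) → w * Z ^ 4 ≠ v * Y ^ 4 →
      (Z : ℝ) ^ (2 : ℝ) < |((w * Z ^ 4 : ℕ) : ℝ) - ((v * Y ^ 4 : ℕ) : ℝ)| :=
  not_ubq₂_of_twoThirteenths_le_of_two_le (2 / 13) 2 le_rfl le_rfl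

/-! ## The FALSE region after cycle 16 -/

/-- **The proved FALSE region after cycle 16**:
`{θ ≥ 2, φ ≥ 0} ∪ {θ ≥ 1, φ ≥ 3/2} ∪ {θ ≥ 2/7, φ ≥ 12/7} ∪ {θ ≥ 2/13, φ > 24/13} ∪ {θ > 0, φ > 2}`
(the cycle-15 lobe `{θ ≥ 1/2, φ ≥ 2}` is inside the third, the edge lobe `{θ ≥ 2/13, φ ≥ 2}` inside the fourth);
open boundary of the Dirichlet edge: `{0 < θ < 2/13, φ = 2}`. -/
theorem ubq₂_false_of_corner₁₁ {θ φ : ℝ}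
    (hc : (2 ≤ θ ∧ 0 ≤ φ) ∨ (1 ≤ θ ∧ 3 / 2 ≤ φ) ∨ (2 / 7 ≤ θ ∧ 12 / 7 ≤ φ) ∨ (2 / 13 ≤ θ ∧ 24 / 13 < φ) ∨
      (0 < θ ∧ 2 < φ)) :
    ¬ ∃ Z₀ : ℕ, ∀ v w Y Z : ℕ, Z₀ ≤ Z → 0 < v → 0 < w → 0 < Y → Nat.Coprime (v * Y) (w * Z) →
      ((max v w : ℕ) : ℝ) ≤ (Z : ℝ) ^ θ → w * Z ^ 4 ≠ v * Y ^ 4 →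
      (Z : ℝ) ^ φ < |((w * Z ^ 4 : ℕ) : ℝ) - ((v * Y ^ 4 : ℕ) : ℝ)| := by
  rcases hc with hc | hc | ⟨hθ, hφ⟩ | ⟨hθ, hφ⟩ | hc
  · exact ubq₂_false_of_corner₁₀ (Or.inl hc)
  · exact ubq₂_false_of_corner₁₀ (Or.inr (Or.inl hc))
  · exact not_ubq₂_of_twoSevenths_le θ φ hθ hφ
  · exact not_ubq₂_of_twoThirteenths_le θ φ hθ hφ
  · exact ubq₂_false_of_corner₁₀ (Or.inr (Or.inr (Or.inr hc)))


end Summit.ABC.ABC.Theorems.TowerFourSubLiouville.Negative
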